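import Summits.BirchSwinnertonDyer.BirchSwinnertonDyer.Theorems.ClassRecordThreeEulerHalvesAtThreeWalkSupplyRootTransverse
import Summits.BirchSwinnertonDyer.BirchSwinnertonDyer.Theorems.Rank1ResidualJetThm63KernelInputsV3
import HarnessLib

/-!
# The Kummer places of the Kolyvagin class `c_k(c)` modulo [GZ86 III (3.1)] with ADMISSIBILITY AS A HYPOTHESIS — image-agnostic
# twin of bsd-jet pv-2's `localization_kolyvaginClass_mem_kummerSelmerStructure_of_GZ31_kolyvagin`, for the non-surjective corner
# (cell `bsd-stepL`, seat `bsd-stepL-corner-p1` g11; `--supports stmt-BirchSwinnertonDyer-19947`)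

WHY. tam3's discharge of the walk's Selmer supply from Poitou–Tate + Gross 1991 §6 (`selmerSupplyAtThree_of_poitouTate_Gross1991`,
helper toward 19109, `ρ̄_{E,3}` ONTO) consumes surjectivity only as ADMISSIBILITY of `E(K[m]) ⊆ E(K̄)` for `p^j` (`E(K[m])[p] = 0`,
x11b3 `RingClassNoTorsion.isAdmissible_pointsSubgroup`), at a handful of leaves. The three ROOT-CLASS leaves already exist in
image-agnostic form (cell bsd-potss, `JetchevIrreducibleCoreVertex.{torsionH1OfDvd_rootClass, localization_rootClass_mem_kummer,
localization_rootClass_mem_globalTransverse}_of_admissible`, p-today) and are REUSED downstream; THIS FILE supplies the remaining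
leaf: `JET.localization_kolyvaginClass_mem_kummerSelmerStructure_of_GZ31_kolyvagin_of_admissible` — bsd-jet pv-2's Kummer
membership of `c_k(c)` at every place off `c` modulo [GZ86 III (3.1)] at Kolyvagin conductors, with the admissibility of the data
at the divisors of `c` an explicit hypothesis `hA` (proof = the original with the one `RingClassNoTorsion` line replaced by `hA`).
On the corner `hA` is x11b3's `NoTorsionIrr.isAdmissible_pointsSubgroup_of_hasIrreducibleModPGaloisRep`. HONEST FRAMING: one
theorem, no definition ∕ fact ∕ sorry; `hGZ` stays a hypothesis; nothing about any curve; no stub closes; T7. Credit: bsd-jet pv-2.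
References (locators only): [cite: GrossLMS1991, §3 (3.1), §6 Prop. 6.2 (1)] [cite: GrossZagier1986, III (3.1)]
[cite: Jetchev2008, Prop. 4.6 (p. 820)].
-/

set_option autoImplicit false

noncomputable section

open scoped Classical Pointwise
open Function NumberField IsDedekindDomain WeierstrassCurve Field
open Literature.NumberTheory.EllipticCurves Literature.NumberTheory.GaloisRepresentations
open Literature.NumberTheory.EllipticCurves.Jetchev2008 Literature.NumberTheory.EllipticCurves.KolyvaginCocycle
open Literature.NumberTheory.EllipticCurves.KolyvaginEuler Literature.NumberTheory.EllipticCurves.RingClassField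
open Literature.NumberTheory.EllipticCurves.ModularForms
open Literature.NumberTheory.GaloisCohomology Literature.NumberTheory.Automorphic
open Literature.NumberTheory.GaloisRepresentations.DiscreteGaloisModule (transverseSubgroup SelmerStructure)
open Summit.BirchSwinnertonDyer.Rank1Residual.JET.SelmerVocabulary
open Summit.BirchSwinnertonDyer.Rank1Residual.JET.GlobalDuality
open Summit.BirchSwinnertonDyer.Rank1Residual.X11b Summit.BirchSwinnertonDyer.Rank1Residual.X11b.Three
open Summit.BirchSwinnertonDyer.Rank1Residual.X11b.Three.GrossBadPlace
open Summit.BirchSwinnertonDyer.Rank1Residual.X11b.KolyvaginHloc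
open Summit.BirchSwinnertonDyer.BirchSwinnertonDyer.Theorems

/-! ## The Kummer places of `c_k(c)` (bsd-jet's leaf) -/

namespace Summit.BirchSwinnertonDyer.Rank1Residual.JET

variable {K : Type} [Field K] [NumberField K] {W : WeierstrassCurve ℚ}

/-- (Admissibility of the data at the divisors of `c` as hypothesis `hA`; image-agnostic twin for the non-surjective corner.)
**The Kummer part of `hκsel` modulo [GZ86 III (3.1)] AT KOLYVAGIN CONDUCTORS** —
`localization_kolyvaginClass_mem_kummerSelmerStructure_of_GZ31` (p498536) with the receptacle schema
`hGZ` asked only at square-free `m` all of whose prime factors are Zhang–Kolyvagin primes (the printed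
scope of Gross 1991 §3 (3.1); the proof calls it at the divisors of `c`, which are such) and the two
Gross §3 CM facts PROVED (`…_holds`). At every place `v` of `K` not over a prime factor of `c`:
`loc_v c_k(c) ∈ H¹_Kum(K_v, E[p^k])`. [cite: GrossLMS1991, §3 (3.1), §6 Prop. 6.2 (1)]
[cite: GrossZagier1986, III (3.1)] [cite: Jetchev2008, §3.3.1/§3.4.1 (p. 816), Prop. 4.6 (p. 820)] -/
theorem localization_kolyvaginClass_mem_kummerSelmerStructure_of_GZ31_kolyvagin_of_admissible [W.IsElliptic]
    [W.IsGloballyMinimal] [NeZero (W.conductorNorm ℤ)]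
    (hK : IsImaginaryQuadratic K) (hD3 : NumberField.discr K ≠ -3) (hD4 : NumberField.discr K ≠ -4)
    (hH : SatisfiesHeegnerHypothesis (W.conductorNorm ℤ) K)
    {p : ℕ} [Fact p.Prime]
    (Dt : ModularParametrizationData W (W.conductorNorm ℤ)) (β : ℤ) (ι : K →+* ℂ)
    {n' : ℤ} (hcop' : IsCoprime (p : ℤ) n')
    (hGZ : ∀ (m : ℕ), Squarefree m →
      (∀ q ∈ m.primeFactors, Zhang2014.IsKolyvaginPrime (W.conductorNorm ℤ) W K p q) →
      ∀ (dm : KolyvaginHeegnerData Dt β ι m)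
      (γ : ringClassField K ι m ≃ₐ[ℚ] ringClassField K ι m), γ ∈ ringClassGal ι m →
      ∀ v : HeightOneSpectrum (𝓞 K), ¬ (W.baseChange K).HasGoodReductionAt v →
        n' • pointsMap (W.baseChange K) (v.adicCompletion K)
            (dm.toGeomPoints (pointGalHom W (ringClassField K ι m) γ dm.y)) ∈
          E0Receptacle (W.baseChange K) v ∧
        ∀ (ℓ : ℕ), ℓ ∈ m.primeFactors → ∀ (dm' : KolyvaginHeegnerData Dt β ι (m / ℓ))
          (hle : ringClassField K ι (m / ℓ) ≤ ringClassField K ι m),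
          n' • pointsMap (W.baseChange K) (v.adicCompletion K)
              (dm.toGeomPoints (pointGalHom W (ringClassField K ι m) γ
                (WeierstrassCurve.Affine.Point.map (W' := W)
                  ((RingClassField.inclusion ι hle).restrictScalars ℚ) dm'.y))) ∈
            E0Receptacle (W.baseChange K) v)
    {c : ℕ} (hc : Squarefree c) {k : ℕ}
    (hcK : ∀ ℓ ∈ c.primeFactors, Zhang2014.IsKolyvaginPrime (W.conductorNorm ℤ) W K p ℓ ∧
      k ≤ Zhang2014.kolyvaginIndex W p ℓ)
    (d : KolyvaginHeegnerData Dt β ι c) [∀ j : ℕ, NumberField (ringClassField K ι j)]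
    (hA : ∀ (m : ℕ), m ∣ c → ∀ dm : KolyvaginHeegnerData Dt β ι m,
      IsAdmissible (absoluteGaloisGroup K) dm.pointsSubgroup ((p ^ k : ℕ) : ℤ))
    (v : Place K) (hv : ∀ ℓ ∈ c.primeFactors, ¬ Jetchev2008.PlaceOver K v ℓ) :
    galoisCohomology.localization ((W.baseChange K).torsionGaloisModule ((p ^ k : ℕ) : ℤ)) v 1
        (d.kolyvaginClass (Fact.out : p.Prime) k) ∈
      (W.baseChange K).kummerSelmerStructure ((p ^ k : ℕ) : ℤ) v := by
  have hp : p.Prime := Fact.out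
  rcases v with w | 𝔳
  · -- complex place: `H¹(ℂ, ·) = 0`
    haveI : IsTotallyComplex K := hK.2
    have hw : w.IsComplex := IsTotallyComplex.isComplex w
    have htop := GlobalDuality.addSubgroup_galoisCohomology_inl_eq_top_of_isComplex
      ((W.baseChange K).torsionGaloisModule ((p ^ k : ℕ) : ℤ)) hw
      ((W.baseChange K).kummerSelmerStructure ((p ^ k : ℕ) : ℤ) (Sum.inl w))
    rw [htop]
    exact AddSubgroup.mem_top _
  · -- finite place `𝔳 ∤ c`
    have hcv : (c : 𝓞 K) ∉ 𝔳.asIdeal := fun h ↦ by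
      obtain ⟨ℓ, hℓ, hℓv⟩ := exists_primeFactor_mem_of_natCast_mem hc 𝔳 h
      exact hv ℓ hℓ ⟨𝔳, rfl, hℓv⟩
    have hND : IsCoprime (W.conductorNorm ℤ : ℤ) (NumberField.discr K) :=
      KolyvaginAssembly.isCoprime_discr_of_satisfiesHeegnerHypothesis hK hH
    have hD : NumberField.discr K < -4 := KolyvaginAssembly.discr_lt_neg_four hK ⟨hD3, hD4⟩
    have hinert : ∀ (m' : ℕ), m' ∣ c → ∀ q ∈ m'.primeFactors, (Ideal.span {(q : 𝓞 K)}).IsPrime :=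
      fun m' hm' q hq ↦ (hcK q (Nat.primeFactors_mono hm' hc.ne_zero hq)).1.2.2.2.2.1
    -- data at every divisor of `c` (the given `d` at `c` itself)
    have hne : ∀ m' : ℕ, m' ∣ c → Nonempty (KolyvaginHeegnerData Dt β ι m') := fun m' hm' ↦
      BirchSwinnertonDyer.Theorems.nonempty_kolyvaginHeegnerData_of_grossCM
        (phi_heegnerPointOfConductor_mem_range_map_ringClassField_holds (W.conductorNorm ℤ) W K)
        exists_generator_ringClassGalOver_holds hK hH Dt β ι
        d.dvd_sq_sub (hc.squarefree_of_dvd hm') (hinert m' hm')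
    let data : (m' : ℕ) → m' ∣ c → KolyvaginHeegnerData Dt β ι m' := fun m' hm' ↦
      if h : m' = c then h ▸ d else (hne m' hm').some
    have hdata : data c dvd_rfl = d := by simp [data]
    have hcop : IsCoprime ((p ^ k : ℕ) : ℤ) n' := by
      rw [Nat.cast_pow]; exact IsCoprime.pow_left hcop'
    -- the guard at a divisor `m ∣ c`: square-free with Zhang–Kolyvagin prime factors
    have hg : ∀ m : ℕ, m ∣ c → Squarefree m ∧
        ∀ q ∈ m.primeFactors, Zhang2014.IsKolyvaginPrime (W.conductorNorm ℤ) W K p q :=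
      fun m hm ↦ ⟨hc.squarefree_of_dvd hm,
        fun q hq ↦ (hcK q (Nat.primeFactors_mono hm hc.ne_zero hq)).1⟩
    have h := hloc_concrete_of_GZ31_zhang hK ι hp Dt hND hD hc hcK data hcop
      (fun m hm γ hγ v hbad ↦ ⟨(hGZ m (hg m hm).1 (hg m hm).2 (data m hm) γ hγ v hbad).1,
        fun ℓ hℓ hle ↦ (hGZ m (hg m hm).1 (hg m hm).2 (data m hm) γ hγ v hbad).2 ℓ hℓ _ hle⟩)
      (fun m hm ↦ hA m hm (data m hm)) c dvd_rfl 𝔳 hcv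
    rw [hdata] at h
    rw [← AddSubgroup.mem_comap, (W.baseChange K).comap_localization_kummerSelmerStructure]
    exact h


end Summit.BirchSwinnertonDyer.Rank1Residual.JET

end
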